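import Mathlib.NumberTheory.ArithmeticFunction.Misc
import Mathlib.Data.Nat.Factorization.Basic
import Mathlib.Data.Real.Basic
import HarnessLib

/-!
# Products of primes from increasing ranges as an iterated Dirichlet convolution

Trunk AntSieve, tooling toward the named fact `Literature.NumberTheory.Sieve.weakDHL_three_two_of_GEH`
(D. H. J. Polymath, Res. Math. Sci. 1:12 (2014) = arXiv:1407.4897, Theorem 3.2(xii)).  In the proof of
Theorem 3.6(ii) (§4.5, p. 17): "one can write `1_{A_{j_1,…,j_r}}` as a convolution
`1_{A_{j_1}} ⋆ ⋯ ⋆ 1_{A_{j_r}}`, where `A_{j_i}` denotes the primes in `I_{j_i}`" — for pairwise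
increasing finite sets of primes (listed from the largest range down; `List.Pairwise`), the indicator of the set of products `p_1 ⋯ p_r`, `p_i ∈ P_i`, is the Dirichlet
product of the indicators (`prod_setIndicatorAF_eq`), because such a product determines its factors
(the largest prime factor lies in `P_r`).

## References

* [Polymath8b2014] D. H. J. Polymath, Res. Math. Sci. 1 (2014), Art. 12 = arXiv:1407.4897,
  §4.5, p. 17.
-/

noncomputable section

open Finset

namespace Literature.NumberTheory.Sieve

/-- The indicator of a finite set of positive integers as a real arithmetic function. [folklore] -/
def setIndicatorAF (P : Finset ℕ) : ArithmeticFunction ℝ :=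
  ⟨fun n => if n ∈ P ∧ n ≠ 0 then 1 else 0, by simp⟩

/-- Values of the indicator. [folklore] -/
theorem setIndicatorAF_apply (P : Finset ℕ) (n : ℕ) :
    setIndicatorAF P n = if n ∈ P ∧ n ≠ 0 then 1 else 0 := rfl

/-- The set of products `p_1 ⋯ p_r` with `p_i ∈ P_i`, for a list of finite sets. [folklore] -/
def tupleProducts : List (Finset ℕ) → Finset ℕ
  | [] => {1}
  | P :: Ps => (tupleProducts Ps ×ˢ P).image fun dp => dp.1 * dp.2

/-- `tupleProducts [] = {1}`. [folklore] -/
@[simp] theorem tupleProducts_nil : tupleProducts [] = {1} := rfl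

/-- The recursion. [folklore] -/
theorem tupleProducts_cons (P : Finset ℕ) (Ps : List (Finset ℕ)) :
    tupleProducts (P :: Ps) = (tupleProducts Ps ×ˢ P).image fun dp => dp.1 * dp.2 := rfl

/-! The hypotheses "all members are primes" and "increasing" (every element of a set placed later in
the list is smaller than every element of a set placed earlier; the HEAD holds the largest primes,
matching the recursion of `tupleProducts`) are spelled with `List.Pairwise`. -/

/-- Elements of `tupleProducts` are positive. [folklore] -/
theorem pos_of_mem_tupleProducts : ∀ {Ps : List (Finset ℕ)}, (∀ P ∈ Ps, ∀ p ∈ P, p.Prime) →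
    ∀ n ∈ tupleProducts Ps, 0 < n
  | [], _, n, hn => by simp at hn; omega
  | P :: Ps, h, n, hn => by
    rw [tupleProducts_cons, Finset.mem_image] at hn
    obtain ⟨⟨d, p⟩, hdp, rfl⟩ := hn
    rw [Finset.mem_product] at hdp
    exact Nat.mul_pos (pos_of_mem_tupleProducts (fun Q hQ => h Q (List.mem_cons_of_mem _ hQ)) d hdp.1)
      (h P List.mem_cons_self p hdp.2).pos

/-- Prime divisors of an element of `tupleProducts Ps` belong to one of the sets. [folklore] -/
theorem exists_mem_of_prime_dvd_tupleProducts : ∀ {Ps : List (Finset ℕ)}, (∀ P ∈ Ps, ∀ p ∈ P, p.Prime) →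
    ∀ {n : ℕ}, n ∈ tupleProducts Ps → ∀ {ℓ : ℕ}, ℓ.Prime → ℓ ∣ n → ∃ Q ∈ Ps, ℓ ∈ Q
  | [], _, n, hn, ℓ, hℓ, hℓn => by
    simp only [tupleProducts_nil, Finset.mem_singleton] at hn
    subst hn
    exact absurd (Nat.le_of_dvd one_pos hℓn) (not_le.2 hℓ.one_lt)
  | P :: Ps, h, n, hn, ℓ, hℓ, hℓn => by
    rw [tupleProducts_cons, Finset.mem_image] at hn
    obtain ⟨⟨d, p⟩, hdp, rfl⟩ := hn
    rw [Finset.mem_product] at hdp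
    rcases (Nat.Prime.dvd_mul hℓ).1 hℓn with hd | hp
    · obtain ⟨Q, hQ, hℓQ⟩ := exists_mem_of_prime_dvd_tupleProducts
        (fun Q hQ => h Q (List.mem_cons_of_mem _ hQ)) hdp.1 hℓ hd
      exact ⟨Q, List.mem_cons_of_mem _ hQ, hℓQ⟩
    · have : ℓ = p := (Nat.prime_dvd_prime_iff_eq hℓ (h P List.mem_cons_self p hdp.2)).1 hp
      exact ⟨P, List.mem_cons_self, this ▸ hdp.2⟩

/-- **Unique factorisation across increasing prime sets**: if `d p = d' p'` with `d, d'` products from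
the earlier sets and `p, p'` primes of the last set, then `(d, p) = (d', p')`. [folklore] -/
theorem tupleProducts_mul_inj {P : Finset ℕ} {Ps : List (Finset ℕ)}
    (hprime : ∀ Q ∈ P :: Ps, ∀ p ∈ Q, p.Prime)
    (hinc : (P :: Ps).Pairwise fun A B => ∀ b ∈ B, ∀ a ∈ A, b < a)
    {d d' p p' : ℕ} (_hd : d ∈ tupleProducts Ps) (hd' : d' ∈ tupleProducts Ps) (hp : p ∈ P) (hp' : p' ∈ P)
    (heq : d * p = d' * p') : d = d' ∧ p = p' := by
  have hpP := hprime P List.mem_cons_self p hp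
  have hp'P := hprime P List.mem_cons_self p' hp'
  -- `p ∣ d' p'`; `p ∣ d'` is impossible (prime factors of `d'` are smaller than `p`)
  have hpdvd : p ∣ d' * p' := ⟨d, by rw [← heq, mul_comm]⟩
  rcases (Nat.Prime.dvd_mul hpP).1 hpdvd with h1 | h2
  · obtain ⟨Q, hQ, hpQ⟩ := exists_mem_of_prime_dvd_tupleProducts
      (fun Q hQ => hprime Q (List.mem_cons_of_mem _ hQ)) hd' hpP h1
    exact absurd ((List.pairwise_cons.1 hinc).1 Q hQ p hpQ p hp) (lt_irrefl p)
  · have hpp' : p = p' := (Nat.prime_dvd_prime_iff_eq hpP hp'P).1 h2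
    subst hpp'
    exact ⟨Nat.eq_of_mul_eq_mul_right hpP.pos heq, rfl⟩

/-- One step: `1_{tupleProducts (P :: Ps)} = 1_{tupleProducts Ps} ⋆ 1_P`. [folklore] -/
theorem setIndicatorAF_tupleProducts_cons {P : Finset ℕ} {Ps : List (Finset ℕ)}
    (hprime : ∀ Q ∈ P :: Ps, ∀ p ∈ Q, p.Prime)
    (hinc : (P :: Ps).Pairwise fun A B => ∀ b ∈ B, ∀ a ∈ A, b < a) :
    setIndicatorAF (tupleProducts (P :: Ps)) = setIndicatorAF (tupleProducts Ps) * setIndicatorAF P := by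
  ext n
  rw [ArithmeticFunction.mul_apply, setIndicatorAF_apply]
  -- the terms of the convolution are the indicator of `S = {(d,p) ∈ antidiag n : d ∈ T, p ∈ P}`
  set S := (n.divisorsAntidiagonal).filter (fun dp => dp.1 ∈ tupleProducts Ps ∧ dp.2 ∈ P) with hS
  have hterms : ∑ dp ∈ n.divisorsAntidiagonal, setIndicatorAF (tupleProducts Ps) dp.1 * setIndicatorAF P dp.2 =
      (#S : ℝ) := by
    rw [Finset.card_eq_sum_ones, Nat.cast_sum, Finset.sum_filter]
    refine Finset.sum_congr rfl fun dp hdp => ?_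
    rw [Nat.mem_divisorsAntidiagonal] at hdp
    have hd0 : dp.1 ≠ 0 := by rintro h0; rw [h0, zero_mul] at hdp; exact hdp.2 hdp.1.symm
    have hp0 : dp.2 ≠ 0 := by rintro h0; rw [h0, mul_zero] at hdp; exact hdp.2 hdp.1.symm
    simp only [setIndicatorAF_apply, hd0, hp0, ne_eq, not_false_eq_true, and_true]
    by_cases h1 : dp.1 ∈ tupleProducts Ps <;> by_cases h2 : dp.2 ∈ P <;> simp [h1, h2]
  rw [hterms]
  -- `#S ≤ 1`, and `S` is nonempty iff `n ∈ tupleProducts (P :: Ps)`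
  have hcard : #S ≤ 1 := by
    rw [Finset.card_le_one]
    intro a ha b hb
    rw [hS, Finset.mem_filter, Nat.mem_divisorsAntidiagonal] at ha hb
    obtain ⟨h1, h2⟩ := tupleProducts_mul_inj hprime hinc ha.2.1 hb.2.1 ha.2.2 hb.2.2 (ha.1.1.trans hb.1.1.symm)
    exact Prod.ext h1 h2
  have hn0 : n ∈ tupleProducts (P :: Ps) → n ≠ 0 := fun hn => (pos_of_mem_tupleProducts hprime n hn).ne'
  by_cases hn : n ∈ tupleProducts (P :: Ps)
  · rw [if_pos ⟨hn, hn0 hn⟩]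
    have hne : S.Nonempty := by
      rw [tupleProducts_cons, Finset.mem_image] at hn
      obtain ⟨⟨d, p⟩, hdp, hdpn⟩ := hn
      refine ⟨(d, p), ?_⟩
      rw [hS, Finset.mem_filter, Nat.mem_divisorsAntidiagonal]
      refine ⟨⟨hdpn, ?_⟩, Finset.mem_product.1 hdp⟩
      rw [← hdpn]
      exact (Nat.mul_pos (pos_of_mem_tupleProducts (fun Q hQ => hprime Q (List.mem_cons_of_mem _ hQ)) d
        (Finset.mem_product.1 hdp).1) (hprime P List.mem_cons_self p (Finset.mem_product.1 hdp).2).pos).ne'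
    have : #S = 1 := le_antisymm hcard (Finset.card_pos.2 hne)
    rw [this]; simp
  · rw [if_neg (fun h' => hn h'.1)]
    have : #S = 0 := by
      rw [Finset.card_eq_zero, Finset.eq_empty_iff_forall_notMem]
      rintro ⟨d, p⟩ hdp
      rw [hS, Finset.mem_filter, Nat.mem_divisorsAntidiagonal] at hdp
      apply hn
      rw [tupleProducts_cons, Finset.mem_image]
      exact ⟨(d, p), Finset.mem_product.2 hdp.2, hdp.1.1⟩
    rw [this]; simp

/-- **Products of primes from increasing ranges as an iterated convolution**:
`1_{tupleProducts Ps} = ∏_{P ∈ Ps} 1_P` (Dirichlet product). [cite: Polymath8b2014, §4.5, p. 17] -/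
theorem setIndicatorAF_tupleProducts_eq_prod : ∀ {Ps : List (Finset ℕ)}, (∀ P ∈ Ps, ∀ p ∈ P, p.Prime) →
    Ps.Pairwise (fun A B => ∀ b ∈ B, ∀ a ∈ A, b < a) →
    setIndicatorAF (tupleProducts Ps) = (Ps.map setIndicatorAF).prod
  | [], _, _ => by
    ext n
    rw [tupleProducts_nil, List.map_nil, List.prod_nil, setIndicatorAF_apply, ArithmeticFunction.one_apply]
    by_cases hn : n = 1 <;> simp [hn]
  | P :: Ps, hprime, hinc => by
    rw [setIndicatorAF_tupleProducts_cons hprime hinc,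
      setIndicatorAF_tupleProducts_eq_prod (fun Q hQ => hprime Q (List.mem_cons_of_mem _ hQ))
        (List.pairwise_cons.1 hinc).2, List.map_cons, List.prod_cons, mul_comm]

end Literature.NumberTheory.Sieve
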